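import Summits.ABC.IUTFork.Repair.RLana91GenuineBed
import Summits.ABC.IUTFork.Cor312PrArchShallowBridge
import HarnessLib

/-!
# REPAIR-CATALOGUE row R-LANA (RC-130 / RC-649) — the CONTAINER GRAIN of the kernel words for Project LANA's (9-1) AS TYPED
# (`Repair.CandLana1.H`): which features of the volume container the verdict reads; at the print-normalised bed it is a DEGREE identity
# (D-0123 (C); seat abc-iut-rcat-tst-9 gen 5; catalogue v1.8 caveat (b) «simplified container» on the K cells of RC-636/644/649)

PROOF-ONLY file (D-0012; no definition, no `Prop` fact; class `Lana`, rows RP-L01 / RC-130 / RC-649; rung LADDER-ABC:A2). TAKES NO SIDE on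
[IUTchIII] Cor. 3.12 / [IUTchIV] Thm. 1.10, on the LANA authors, or on any author or repository; nothing here asserts abc proved or refuted;
REFUTED-AS-TYPED ≠ refuted-in-print; external tracker text = DATA. The catalogue's caveat (b) records, from the LANA programme's public tracker
(as served, second-hand via abc-iut-rcat-lit-3 / lit-5 L5-39), that the interim report's volume container is a SIMPLIFICATION of [IUTchIII]
Props. 3.1–3.3 / 3.9 («v_ℚ-level direct-sum decomposition, procession labels and tensor-packet normalisation … retained only in the programme's
later Lean API»), so that «verdict words obtained in the report's container read as-typed (simplified container)». THIS FILE makes the container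
grain of OUR words for (9-1) kernel-visible; the companion `RLana91ArchCorner` treats the one axis along which the kill's mechanism changes.

WHAT IS PROVED.
* §1 (FRAME LEVEL, container-PARAMETRIC — any `LatticeSituation`, any `Cor312.Setting`; the packets are the tensor packets
  `log(^{S^±_{j+1}}𝒟^⊢_{v_ℚ}) = ⨂_{S^±_{j+1}} (v_ℚ-packet)` of [IUTchIII] Props. 3.1/3.2, abc-iut-c312-7 `Cor312.packet_eq_mpacketN`; the volume is
  the signature's `MRData.logvol` of Prop. 3.9 (ii), summed over `v_ℚ` (Prop. 3.9 (iii)) and procession-normalised over `j ∈ 𝔽_l^⋇` (Prop. 3.9 (i))):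
  `H_iff_negLogQ_mem_range` — (9-1) as typed reads the container ONLY through the SET of procession-normalised global possible-image volumes and
  the number `−|log(q)|` (the «volume-class grain» of rows RC-130 / RC-649 as a kernel statement); `H_iff_thetaRegion3_of_stepX` — under
  [IUTchIII] Cor. 3.12 Step (x) volume-invariance of (Ind1)/(Ind2) («the resulting log-volumes … are invariant», p. 181) in ANY container, (9-1) as
  typed ⟺ the (Ind3)-enlarged Kummer image ITSELF has procession volume `−|log(q)|` (container-parametric form of this seat's gen-2
  `RLana91InputConstruction.H_settingPrVolSharp_iff_kummerImage`, p518179).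
* §2 (PRINT-NORMALISED nonarchimedean container, trivial `∞` — abc-iut-c312-7's `settingPrVolSharp` over abc-iut-c312-1-g5's `summandPiecesPr`:
  the VERBATIM container of [IUTchIII] Rmk. 3.1.1 (ii)(iii) on the real prime packets `F_{v_0} ⊗_{ℚ_p} ⋯ ⊗_{ℚ_p} F_{v_j}` with direct-sum summands
  `v⃗` and the PROBABILITY weights realising print's normalisation — NOT the report's simplified container): `H_settingPrVolSharp_iff_ndeg` —
  (9-1) as typed ⟺ the DEGREE identity `deĝ̲_lgp(P_Θ) = deĝ̲(P_q)` (every container feature is integrated out by Prop. 3.9 (iii) «global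
  log-volume = degree»), ⟺ `((l+1)/24 − 1/(2l))·deĝ̲(𝔮) = 0` (`H_settingPrVolSharp_iff_gap_eq_zero`); false since `deĝ̲(𝔮) > 0` and
  `(l+1)/24 > 1/(2l)` — which IS the landed kill `RLana91GenuineBed.not_H_settingPrVolSharp` (p511969), read through the iff.

READING for the catalogue (numbers and decl names, not adjectives; no side). Caveat (b) names NONARCHIMEDEAN container structure; the tst-9
kill of record was computed in the print-normalised tensor-packet container, not in the report's simplified one (§2 is the reduction to
degrees), and it is container-parametric in the precise sense of §1 together with abc-iut-rp-cx's frame-level ceiling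
`Repair.EvalHonestCeilingL01.l01_false_of_honestData` (BridgeHyps · Step (x) · exact `j²`-scaling · label-independent `q`-volume · `|log q| > 0`).
The toy-model words of `Repair.CandLana1` / `RLana91CellGrain` (CM `not_H_pinned`, the separations at `e = (2,3)` and the frame flip) are
one-place `l⋇ = 2` models — valid as separations of the TYPED predicates (a non-implication needs one model), silent about the arithmetic
container. HONEST SCOPE: statements about OUR typed objects at OUR beds (volume-preserving (Ind1)/(Ind2), (Ind3) absorbed in the sharp boxes);
(9-1) is the report's self-declared open goal (§10.5 p. 49); refuted-as-typed ≠ refuted-in-print; typed ≠ proved; instantiated ≠ endorsed.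
[cite: LANA2026Report, §9.2 (9-1) p. 46; §10.3 p. 48; §10.5 p. 49] [cite: Mochizuki2012, IUTchIII Prop. 3.9 (i)–(iii) p. 117; Cor. 3.12
p. 173–174; proof Step (x) p. 181] [cite: DupuyHilado2025, Def. 3.1.1, §3.3, §3.4, Thm. 3.10.1] [claim: Mochizuki2012, status: disputed] for
every quoted construction.
-/
noncomputable section

open Set Function NumberField IsDedekindDomain

namespace Summit.ABC.IUTFork.Repair.RLana91ContainerGrain

open Thm311 Thm311.Real Cor312 Cor312Vol Literature.IUT.LogThetaLattice Literature.IUT.LogVolume Literature.IUT.HodgeTheaters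
  Literature.NumberTheory.NumberFields

/-! ## §1. Frame level (container-parametric) -/

section Frame

variable {T : ThetaIndex} (S : LatticeSituation T) (P : Cor312.Setting S.toSituation)
  (ρ : (∀ v : T.V, v ∈ T.Vbad → Set (S.L.StarPacket v)) → ∀ (j : T.Label) (vQ : T.VQ), Set (S.L.Packet j vQ))
  (qK : ∀ v : T.V, v ∈ T.Vbad → Set (S.L.StarPacket v))

/-- **VOLUME-CLASS GRAIN (rows RC-130 / RC-649) as a kernel statement.** In ANY container, (9-1) as typed reads the volume container only
through the SET of procession-normalised global possible-image volumes (`𝔼_{j∈𝔽_l^⋇} Σ_{v_ℚ} μ^log_{j,v_ℚ}(U_{j,v_ℚ})`, [IUTchIII] Prop. 3.9 (i)–(iii))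
and the number `−|log(q)|`: `H ⟺ −|log(q)| ∈ {volumes of global possible images}`. [cite: LANA2026Report, §9.2 (9-1) p. 46]
[cite: Mochizuki2012, IUTchIII Prop. 3.9 (i)–(iii) p. 117] -/
theorem H_iff_negLogQ_mem_range :
    CandLana1.H S P ρ qK ↔
      P.negLogQ ∈ Set.range (fun U : ImageChoice P =>
        processionNormalized (fun i : Fin T.lstar => ∑ᶠ vQ : T.VQ, (S.D P.n).logvol _ vQ (U.1 (i, vQ)))) :=
  ⟨fun ⟨U, hU⟩ => ⟨U, hU⟩, fun ⟨U, hU⟩ => ⟨U, hU⟩⟩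

/-- **STEP (x) REDUCTION, container-parametric.** If in every packet `(j, v_ℚ)`, `j ∈ 𝔽_l^⋇`, every possible image of the Θ-pilot object has the
log-volume of the (Ind3)-enlarged Kummer image ([IUTchIII] proof of Cor. 3.12, Step (x), p. 181: «the resulting log-volumes … are invariant with
respect to the indeterminacies (Ind1), (Ind2)» — a property of the CONTAINER, whatever its normalisation), then (9-1) as typed holds iff the
(Ind3)-enlarged Kummer image ITSELF has procession-normalised volume `−|log(q)|`: the «∃ suitable S» has no freedom left at the level of volume
classes. [cite: Mochizuki2012, IUTchIII Cor. 3.12 proof Step (x) p. 181] [cite: LANA2026Report, §9.2 (9-1) p. 46] -/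
theorem H_iff_thetaRegion3_of_stepX
    (hx : ∀ (i : Fin T.lstar) (vQ : T.VQ) (U : Set (S.L.Packet (Setting.labelSucc i) vQ)),
      U ∈ P.possibleImages (Setting.labelSucc i) vQ →
        (S.D P.n).logvol _ vQ U = (S.D P.n).logvol _ vQ (P.thetaRegion3 (Setting.labelSucc i) vQ)) :
    CandLana1.H S P ρ qK ↔
      processionNormalized (fun i : Fin T.lstar => ∑ᶠ vQ : T.VQ,
        (S.D P.n).logvol _ vQ (P.thetaRegion3 (Setting.labelSucc i) vQ)) = P.negLogQ := by
  constructor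
  · rintro ⟨U, hU⟩
    have hfun : (fun i : Fin T.lstar => ∑ᶠ vQ : T.VQ, (S.D P.n).logvol _ vQ (P.thetaRegion3 (Setting.labelSucc i) vQ)) =
        fun i : Fin T.lstar => ∑ᶠ vQ : T.VQ, (S.D P.n).logvol _ vQ (U.1 (i, vQ)) := by
      funext i
      exact finsum_congr fun vQ => (hx i vQ _ (U.2 (i, vQ))).symm
    rw [hfun]
    exact hU
  · intro h
    exact ⟨⟨fun t => P.thetaRegion3 _ t.2, fun t => P.thetaRegion3_mem_possibleImages _ t.2⟩, h⟩

end Frame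

/-! ## §2. The print-normalised nonarchimedean container (trivial `∞`): (9-1) as typed is a DEGREE identity -/

section Genuine

variable {F : Type} [Field F] [NumberField F] (X : PilotData F) {logv : PadicLogs F} (hlog : LogvAnalytic logv)
  (M : Type) [Field M] [NumberField M]
  (archPk : ∀ (j : (thetaIndex X).Label) (vQ : (thetaIndex X).VQ), Set ((logShellsDH X logv).Packet j vQ))
  (archSub : ∀ (j : (thetaIndex X).Label) (v : (thetaIndex X).V),
    Set ((logShellsDH X logv).Packet j ((thetaIndex X).over v)))
  (Ψ : ℤ → ∀ v : (thetaIndex X).V, v ∈ (thetaIndex X).Vbad → Set ((logShellsDH X logv).StarPacket v))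
  (act : ℤ → ∀ v : (thetaIndex X).V, v ∈ (thetaIndex X).Vbad →
    (logShellsDH X logv).StarPacket v → Module.End ℚ ((logShellsDH X logv).StarPacket v))
  (Mmod : ℤ → ∀ j : (thetaIndex X).LabelStar, Set ((logShellsDH X logv).GlobalPacket j.1))
  (region : ℤ → ∀ j : (thetaIndex X).LabelStar, FinDivisor M → ∀ vQ : (thetaIndex X).VQ,
    Set ((logShellsDH X logv).Packet j.1 vQ))
  (frobAdm : ℤ → ℤ → ∀ (j : (thetaIndex X).Label) (vQ : (thetaIndex X).VQ),
    Set ((logShellsDH X logv).Packet j vQ) → Prop)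
  (frobLogvol : ℤ → ℤ → ∀ (j : (thetaIndex X).Label) (vQ : (thetaIndex X).VQ),
    Set ((logShellsDH X logv).Packet j vQ) → ℝ)
  (frobΨ : ℤ → ℤ → ∀ v : (thetaIndex X).V, v ∈ (thetaIndex X).Vbad → Set ((logShellsDH X logv).StarPacket v))
  (frobMmod : ℤ → ℤ → ∀ j : (thetaIndex X).LabelStar, Set ((logShellsDH X logv).GlobalPacket j.1))
  (unitImage : ℤ → ℤ → ℕ → ∀ (j : (thetaIndex X).Label) (vQ : (thetaIndex X).VQ),
    Set ((logShellsDH X logv).Packet j vQ))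
  (ballImage : ℤ → ℤ → ∀ (j : (thetaIndex X).Label) (vQ : (thetaIndex X).VQ),
    Set ((logShellsDH X logv).Packet j vQ))
  (thetaDiv : ℤ → ℤ → LgpDivisor M (thetaIndex X).lstar)
  (n : ℤ) {HT : Type} {LogLink : HT → HT → Type} {IsFull : ∀ {s t : HT}, LogLink s t → Prop}
  (lat : LGPGaussianLogThetaLattice LogLink IsFull)
  {Frd : Type} {IsoF : Frd → Frd → Type} {Ob : Frd → Type} {realify : Frd → Frd} {Strip : Type}
  {IsoS : Strip → Strip → Type} {Mv : ∀ v : (thetaIndex X).V, v ∈ (thetaIndex X).Vbad → Type}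
  [∀ v h, Monoid (Mv v h)]
  (sig : GlobalLGPFrobenioidSignature (thetaIndex X).lstar (thetaIndex X).V (· ∈ (thetaIndex X).Vbad)
    Frd IsoF Ob realify Strip IsoS Mv)
  (split : SplittingMonoids Mv) {ObΔ : Type} {N : ∀ v : (thetaIndex X).V, v ∈ (thetaIndex X).Vbad → Type}
  [∀ v h, Monoid (N v h)] (qData : QPilotData ObΔ N)
  (t : ∀ (pp : Nat.Primes) (_ : Fin X.lstar) (x : (thetaIndex X).Fibre (.inr pp)),
    haveI : Fact (pp : ℕ).Prime := ⟨pp.2⟩; kOf X pp.1 x)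
  (tq : ∀ (pp : Nat.Primes) (x : (thetaIndex X).Fibre (.inr pp)), haveI : Fact (pp : ℕ).Prime := ⟨pp.2⟩; kOf X pp.1 x)
  (ρ : (∀ v : (thetaIndex X).V, v ∈ (thetaIndex X).Vbad → Set ((logShellsDH X logv).StarPacket v)) →
    ∀ (j : (thetaIndex X).Label) (vQ : (thetaIndex X).VQ), Set ((logShellsDH X logv).Packet j vQ))
  (qK : ∀ v : (thetaIndex X).V, v ∈ (thetaIndex X).Vbad → Set ((logShellsDH X logv).StarPacket v))

/-- **(9-1) AS TYPED AT THE PRINT-NORMALISED GENUINE SHARP BED ⟺ `deĝ̲_lgp(P_Θ) = deĝ̲(P_q)`** (Θ-, `q`-ideles realising `P_Θ`, `P_q`): every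
global possible image has procession volume `−deĝ̲_lgp(P_Θ)` (abc-iut-s2-p9 `processionNormalized_imageChoice_settingPrVolSharp`), `−|log(q)| =
−deĝ̲(P_q)` (abc-iut-c312-7 `negLogQ_settingPrVolSharp`), and global possible images exist (`imageChoice_nonempty`). The tensor-packet structure,
the direct-sum summands `v⃗` and the probability weights of the container are all integrated out by [IUTchIII] Prop. 3.9 (iii).
[cite: DupuyHilado2025, §3.4, Thm. 3.10.1] [cite: Mochizuki2012, IUTchIII Prop. 3.9 (iii) p. 117] -/
theorem H_settingPrVolSharp_iff_ndeg (ht0 : ∀ pp i x, t pp i x ≠ 0)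
    (ht : ∀ (pp : Nat.Primes) (i : Fin X.lstar) (x : (thetaIndex X).Fibre (.inr pp)),
      haveI : Fact (pp : ℕ).Prime := ⟨pp.2⟩
      Real.log ‖t pp i x‖ = -(X.thetaPilot i (placeOf X pp.1 x)) * logNorm F (placeOf X pp.1 x) /
        localDegree F (placeOf X pp.1 x))
    (htq0 : ∀ pp x, tq pp x ≠ 0)
    (htq1 : ∀ (pp : Nat.Primes) (x : (thetaIndex X).Fibre (.inr pp)),
      haveI : Fact (pp : ℕ).Prime := ⟨pp.2⟩; placeOf X pp.1 x ∉ X.S → ‖tq pp x‖ = 1)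
    (htq : ∀ (pp : Nat.Primes) (x : (thetaIndex X).Fibre (.inr pp)),
      haveI : Fact (pp : ℕ).Prime := ⟨pp.2⟩
      Real.log ‖tq pp x‖ = -(X.qPilot (placeOf X pp.1 x)) * logNorm F (placeOf X pp.1 x) /
        localDegree F (placeOf X pp.1 x)) :
    Repair.CandLana1.H
      (LatticeSituation.ofShells (logShellsDH X logv) M archPk archSub (summandPiecesPr X hlog).Adm
        (summandPiecesPr X hlog).logvol Ψ act Mmod region frobAdm frobLogvol frobΨ frobMmod unitImage ballImage thetaDiv)
      (settingPrVolSharp X hlog M archPk archSub Ψ act Mmod region n lat sig split qData tq t htq0 htq1) ρ qK ↔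
      -LgpDivisor.ndegLgp X.thetaPilot = -FinDivisor.ndeg F X.qPilot := by
  have hq := negLogQ_settingPrVolSharp X hlog M archPk archSub Ψ act Mmod region n lat sig split qData t tq htq0 htq1 htq
  constructor
  · rintro ⟨U, hU⟩
    have hU' := processionNormalized_imageChoice_settingPrVolSharp X hlog M archPk archSub Ψ act Mmod region n lat sig split
      qData tq t htq0 htq1 ht0 ht U
    exact hU'.symm.trans (hU.trans hq)
  · intro h
    obtain ⟨U⟩ := imageChoice_nonempty
      (settingPrVolSharp X hlog M archPk archSub Ψ act Mmod region n lat sig split qData tq t htq0 htq1)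
    exact ⟨U, (processionNormalized_imageChoice_settingPrVolSharp X hlog M archPk archSub Ψ act Mmod region n lat sig split
      qData tq t htq0 htq1 ht0 ht U).trans (h.trans hq.symm)⟩

/-- **… ⟺ `((l+1)/24 − 1/(2l))·deĝ̲(𝔮) = 0`** — the pilot-degree gap in closed form (abc-iut-c312-3 `degLgp_thetaPilot_sub_deg_qPilot`, normalised:
`Thm311.Real.kappa_mul_ndeg_qDivisor_eq_gap`). [cite: DupuyHilado2025, Def. 3.1.1, §3.3] -/
theorem H_settingPrVolSharp_iff_gap_eq_zero (ht0 : ∀ pp i x, t pp i x ≠ 0)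
    (ht : ∀ (pp : Nat.Primes) (i : Fin X.lstar) (x : (thetaIndex X).Fibre (.inr pp)),
      haveI : Fact (pp : ℕ).Prime := ⟨pp.2⟩
      Real.log ‖t pp i x‖ = -(X.thetaPilot i (placeOf X pp.1 x)) * logNorm F (placeOf X pp.1 x) /
        localDegree F (placeOf X pp.1 x))
    (htq0 : ∀ pp x, tq pp x ≠ 0)
    (htq1 : ∀ (pp : Nat.Primes) (x : (thetaIndex X).Fibre (.inr pp)),
      haveI : Fact (pp : ℕ).Prime := ⟨pp.2⟩; placeOf X pp.1 x ∉ X.S → ‖tq pp x‖ = 1)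
    (htq : ∀ (pp : Nat.Primes) (x : (thetaIndex X).Fibre (.inr pp)),
      haveI : Fact (pp : ℕ).Prime := ⟨pp.2⟩
      Real.log ‖tq pp x‖ = -(X.qPilot (placeOf X pp.1 x)) * logNorm F (placeOf X pp.1 x) /
        localDegree F (placeOf X pp.1 x)) :
    Repair.CandLana1.H
      (LatticeSituation.ofShells (logShellsDH X logv) M archPk archSub (summandPiecesPr X hlog).Adm
        (summandPiecesPr X hlog).logvol Ψ act Mmod region frobAdm frobLogvol frobΨ frobMmod unitImage ballImage thetaDiv)
      (settingPrVolSharp X hlog M archPk archSub Ψ act Mmod region n lat sig split qData tq t htq0 htq1) ρ qK ↔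
      (((X.l : ℝ) + 1) / 24 - 1 / (2 * (X.l : ℝ))) * FinDivisor.ndeg F X.qDivisor = 0 := by
  rw [H_settingPrVolSharp_iff_ndeg X hlog M archPk archSub Ψ act Mmod region frobAdm frobLogvol frobΨ frobMmod unitImage ballImage
    thetaDiv n lat sig split qData t tq ρ qK ht0 ht htq0 htq1 htq, kappa_mul_ndeg_qDivisor_eq_gap X]
  constructor <;> intro h <;> linarith

end Genuine

end Summit.ABC.IUTFork.Repair.RLana91ContainerGrain

end
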